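import Summits.HodgeConjecture.HodgeConjecture.Theorems.R90S6TwistedTreeInvolutionRankOne   -- W11 FILE 1: `thetaTreeIso`, (T.1) `thetaTreeIso_apply_coe`, (T.3)
import HarnessLib

/-!
# R90 · S6 «Ch. 14.1–14.5 stable TF» — card W11, FILE 1b: THE FIXED VERTICES OF THE `Θσ`-INVOLUTION ARE THE VERTICES OF THE `U(1,1)` TREE («TREE IN TREE»)
# (`Theorems/R90S6TwistedTreeInvolutionFixedRankOne.lean`; DAG E1.4.4.3.2)

Cell `hodgecm-mathlib`, crux H413 (`stmt-HodgeConjecture-24833`), route of record `HCCMUnconditional`; programme R90-TF, section S6 (base `R90-C14`),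
seat K2Liu-p27 (g4); S6 dealer R90-C14-plan (g2) CARD W11, FILE 1b «=» 2026-09-05T03:01:08Z.  Sequel of FILE 1 ★ `R90S6TwistedTreeInvolutionRankOne`
(`thetaTreeIso`: `θ̄ (latt h) = latt (D·σ(h))`, `D = diag(−1,1)`).  Lane `--supports stmt-HodgeConjecture-24833 --as helper`; THEOREMS ONLY.

THE MATHEMATICS.  `w = (0 1; 1 0)` is the hermitian form of `U(1,1) = U(σ, w) = Fix Θσ`; its tree `latticeTree σ ϖ w` (★ `HermitianLatticeTreeDefs`: vertices = the
`w`-self-dual and the `w`-`ϖ`-modular lattices) sits inside the tree of `GL₂(E)`.  KEY IDENTITY (2 × 2): for a frame `h` with θ-frame `θ = D·σ(h)` and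
`k := θ⁻¹ h`, the `w`-Gram matrix of `h` is
  `ᵗ(σh) · w · h = σ(det h) • (J · k)`, `J = (0 1; −1 0)`
(`σ(h) = D θ`, `D w = −J`, and `ᵗA J = det A • J A⁻¹`).  Hence `θ̄ [latt h] = [latt h]` — i.e. `k ∈ GL₂(𝒪)` — iff the Gram matrix is `σ(det h)` times a unimodular
matrix, i.e. iff `latt h` is `w`-self-dual (`|det h| = 1`) or `w`-`ϖ`-modular (`|det h| = |ϖ|`):
* §2 **`thetaTreeIso_eq_self_iff`** (T.5): `θ̄ M = M ↔ IsSpecialLattice σ ϖ w M.1` — the fixed vertex set of `θ̄` is the vertex set of `latticeTree σ ϖ w`, and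
  **`isSelfDualLattice_hermitian_iff`**: `IsSelfDualLattice σ w M.1 ↔ θ̄ M = M ∧ IsSelfDualLattice id J M.1` (type for type: the `(q_F+1)`-regular tree of
  `U(1,1)_w` embedded colour-preservingly in the `(q_E+1)`-regular tree of `GL₂(E_w)`).
* §3 **`thetaTreeIso_glVertexAct`** (T.4, `𝒪[E]` a DVR): `θ̄ (g • M) = Θ(g) • θ̄ M` for the action `• = glVertexAct hϖ` of `GL₂(E)` through `PGL₂(E)` (★ (W1c)-A) and
  `Θ = UnitaryGroup.qsInvolution σ` — the semiconjugation making `τ_δ := glTreeIso δ ∘ θ̄` (FILE 2's twisted displacement map) equivariant, `τ_δ² = (δ·Θδ)•`.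
HONEST LABEL: lattice bookkeeping for the count layer of E1.4.4.3.2 (the fixed set that ★ W8-f ∕ K2E3-p28's inversion edition count against), count-neutral; proves no
printed global statement; HC_CM is proved only modulo the 7 printed citations (2 remaining named inputs: hLiu418 = stmt-HodgeConjecture-24832, h413 =
stmt-HodgeConjecture-24833) until rung 0 closes; REL ≠ ★ ≠ BUILT.

## References
* [Rogawski1990] J. D. Rogawski, *Automorphic Representations of Unitary Groups in Three Variables*, Ann. of Math. Stud. 123 (1990), §1.9 p. 8, §4.11 pp. 58–60, §11.5 L. 11.5.3.
* [Langlands1980AMS96] R. P. Langlands, *Base Change for GL(2)*, Ann. of Math. Stud. 96 (1980), §5.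
* [Serre1980Trees] J.-P. Serre, *Trees* (1980), Ch. II §1.1–§1.3.
* [Jacobowitz1962] R. Jacobowitz, *Hermitian forms over local fields*, Amer. J. Math. 84 (1962), §7–§8.
-/

set_option autoImplicit false
-- the mandated namespace repeats the single-problem summit's segment (`HodgeConjecture.HodgeConjecture`)
set_option linter.dupNamespace false

noncomputable section

open scoped ValuativeRel Matrix MatrixGroups
open Matrix ValuativeRel
open Literature.NumberTheory.Automorphic Literature.NumberTheory.Automorphic.HermitianLatticeTree

namespace Summit.HodgeConjecture.HodgeConjecture.R90.S6

variable {E : Type*} [Field E]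

/-! ## §1 The 2 × 2 identity `ᵗ(σh)·w·h = σ(det h) • J·(θ⁻¹h)` -/

section Algebra

variable (σ : E →+* E)

/-- The θ-frame matrix has determinant `−σ(det h)`. [folklore] -/
private theorem det_theta' (h : GL (Fin 2) E) :
    Matrix.det !![-σ ((h : Matrix (Fin 2) (Fin 2) E) 0 0), -σ ((h : Matrix (Fin 2) (Fin 2) E) 0 1);
        σ ((h : Matrix (Fin 2) (Fin 2) E) 1 0), σ ((h : Matrix (Fin 2) (Fin 2) E) 1 1)] = -σ ((h : Matrix (Fin 2) (Fin 2) E).det) := by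
  rw [Matrix.det_fin_two_of, Matrix.det_fin_two, map_sub, map_mul, map_mul]
  ring

/-- The θ-frame is invertible. [folklore] -/
private theorem isUnit_det_theta' (h : GL (Fin 2) E) :
    IsUnit (Matrix.det !![-σ ((h : Matrix (Fin 2) (Fin 2) E) 0 0), -σ ((h : Matrix (Fin 2) (Fin 2) E) 0 1);
        σ ((h : Matrix (Fin 2) (Fin 2) E) 1 0), σ ((h : Matrix (Fin 2) (Fin 2) E) 1 1)]) := by
  rw [det_theta']
  exact isUnit_iff_ne_zero.2 (neg_ne_zero.2 ((map_ne_zero σ).2 (h.isUnit.map Matrix.detMonoidHom).ne_zero))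

/-- `σ(h) = D · θ` (`D = diag(−1,1)`, `D² = 1`). [folklore] -/
private theorem map_eq_negRow_mul_theta (h : GL (Fin 2) E) :
    ((h : Matrix (Fin 2) (Fin 2) E)).map σ =
      !![-1, 0; 0, 1] * !![-σ ((h : Matrix (Fin 2) (Fin 2) E) 0 0), -σ ((h : Matrix (Fin 2) (Fin 2) E) 0 1);
        σ ((h : Matrix (Fin 2) (Fin 2) E) 1 0), σ ((h : Matrix (Fin 2) (Fin 2) E) 1 1)] := by
  ext i j
  fin_cases i <;> fin_cases j <;> simp [Matrix.mul_apply, Fin.sum_univ_two]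

/-- `ᵗA · J · A = det A • J` for every `2 × 2` matrix (`J = (0 1; −1 0)`). [folklore] -/
private theorem transpose_mul_J_mul (A : Matrix (Fin 2) (Fin 2) E) :
    Aᵀ * !![(0 : E), 1; -1, 0] * A = A.det • !![(0 : E), 1; -1, 0] := by
  ext i j
  rw [Matrix.det_fin_two]
  fin_cases i <;> fin_cases j <;> simp [Matrix.mul_apply, Fin.sum_univ_two] <;> ring

/-- **THE GRAM IDENTITY**: `ᵗ(σh) · w · h = −(ᵗθ · J · h)` with `θ` the θ-frame (`σ(h) = Dθ`, `ᵗD w = D w = −J`). [folklore] -/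
private theorem formCongr_w_eq (h : GL (Fin 2) E) :
    formCongr σ h !![(0 : E), 1; 1, 0] =
      -((!![-σ ((h : Matrix (Fin 2) (Fin 2) E) 0 0), -σ ((h : Matrix (Fin 2) (Fin 2) E) 0 1);
          σ ((h : Matrix (Fin 2) (Fin 2) E) 1 0), σ ((h : Matrix (Fin 2) (Fin 2) E) 1 1)] : Matrix (Fin 2) (Fin 2) E)ᵀ *
        !![(0 : E), 1; -1, 0] * (h : Matrix (Fin 2) (Fin 2) E)) := by
  have hDw : ((!![-1, 0; 0, 1] : Matrix (Fin 2) (Fin 2) E))ᵀ * !![(0 : E), 1; 1, 0] = -!![(0 : E), 1; -1, 0] := by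
    ext i j; fin_cases i <;> fin_cases j <;> simp [Matrix.mul_apply, Fin.sum_univ_two, Matrix.transpose_apply]
  rw [formCongr, map_eq_negRow_mul_theta, Matrix.transpose_mul, Matrix.mul_assoc _ _ (!![(0 : E), 1; 1, 0]), hDw, Matrix.mul_neg, Matrix.neg_mul]

/-- **`ᵗ(σh)·w·h = σ(det h) • J·(θ⁻¹·h)`**: the `w`-Gram matrix of `h` is `σ(det h)` times `J·K`, `K = θ⁻¹h` (`ᵗθ J = det θ • J θ⁻¹`, `det θ = −σ det h`). [folklore] -/
private theorem formCongr_w_eq_smul (h : GL (Fin 2) E) :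
    formCongr σ h !![(0 : E), 1; 1, 0] =
      σ ((h : Matrix (Fin 2) (Fin 2) E).det) • (!![(0 : E), 1; -1, 0] *
        ((!![-σ ((h : Matrix (Fin 2) (Fin 2) E) 0 0), -σ ((h : Matrix (Fin 2) (Fin 2) E) 0 1);
            σ ((h : Matrix (Fin 2) (Fin 2) E) 1 0), σ ((h : Matrix (Fin 2) (Fin 2) E) 1 1)] : Matrix (Fin 2) (Fin 2) E)⁻¹ *
          (h : Matrix (Fin 2) (Fin 2) E))) := by
  rw [formCongr_w_eq]
  set θ : Matrix (Fin 2) (Fin 2) E := !![-σ ((h : Matrix (Fin 2) (Fin 2) E) 0 0), -σ ((h : Matrix (Fin 2) (Fin 2) E) 0 1);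
    σ ((h : Matrix (Fin 2) (Fin 2) E) 1 0), σ ((h : Matrix (Fin 2) (Fin 2) E) 1 1)] with hθ
  have hkey : θᵀ * !![(0 : E), 1; -1, 0] = θ.det • (!![(0 : E), 1; -1, 0] * θ⁻¹) :=
    calc θᵀ * !![(0 : E), 1; -1, 0] = θᵀ * !![(0 : E), 1; -1, 0] * θ * θ⁻¹ :=
          (Matrix.mul_nonsing_inv_cancel_right θ _ (isUnit_det_theta' σ h)).symm
      _ = θ.det • (!![(0 : E), 1; -1, 0] * θ⁻¹) := by rw [transpose_mul_J_mul, Matrix.smul_mul]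
  rw [hkey, Matrix.smul_mul, hθ, det_theta', neg_smul, neg_neg, Matrix.mul_assoc]

/-- The matrix of `θ⁻¹ · h` in `GL₂(E)`. [folklore] -/
private theorem coe_thetaInv_mul (h : GL (Fin 2) E) :
    ((((Matrix.GeneralLinearGroup.mk'' _ (isUnit_det_theta' σ h))⁻¹ * h : GL (Fin 2) E)) : Matrix (Fin 2) (Fin 2) E) =
      (!![-σ ((h : Matrix (Fin 2) (Fin 2) E) 0 0), -σ ((h : Matrix (Fin 2) (Fin 2) E) 0 1);
          σ ((h : Matrix (Fin 2) (Fin 2) E) 1 0), σ ((h : Matrix (Fin 2) (Fin 2) E) 1 1)] : Matrix (Fin 2) (Fin 2) E)⁻¹ *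
        (h : Matrix (Fin 2) (Fin 2) E) := by
  rw [Units.val_mul, Matrix.coe_units_inv]
  rfl

/-- `J² = −1`. [folklore] -/
private theorem J_mul_J : (!![(0 : E), 1; -1, 0] : Matrix (Fin 2) (Fin 2) E) * !![(0 : E), 1; -1, 0] = -1 := by
  ext i j; fin_cases i <;> fin_cases j <;> simp

/-- Solving the Gram identity for `K`: from `G = c • (J·K)` (`c ≠ 0`), `K = −(c⁻¹ • (J·G))`. [folklore] -/
private theorem eq_neg_smul_J_mul_of_eq {G K : Matrix (Fin 2) (Fin 2) E} {c : E} (hc : c ≠ 0) (hG : G = c • (!![(0 : E), 1; -1, 0] * K)) :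
    K = -(c⁻¹ • (!![(0 : E), 1; -1, 0] * G)) := by
  rw [hG, Matrix.mul_smul, ← Matrix.mul_assoc, J_mul_J, neg_mul, one_mul, smul_neg, smul_neg, neg_neg, smul_smul, inv_mul_cancel₀ hc, one_smul]

end Algebra

/-! ## §2 (T.5) The fixed vertices of `θ̄` -/

section Fixed

variable [ValuativeRel E] {ϖ : E} (hϖ : IsUniformizingElement ϖ) (σ : E →+* E)
  (hσv : ∀ x : E, valuation E (σ x) = valuation E x) (hσσ : ∀ x : E, σ (σ x) = x)

/-- `θ̄ M = M` iff `θ⁻¹ h ∈ GL₂(𝒪)` for a frame `h` of `M`. [cite: Serre1980Trees, Ch. II §1.1] -/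
private theorem thetaTreeIso_eq_self_iff_mem_glInt
    (M : {M : Submodule 𝒪[E] (Fin 2 → E) // IsSpecialLattice (RingHom.id E) ϖ !![(0 : E), 1; -1, 0] M})
    {h : GL (Fin 2) E} (hM : M.1 = latt (h : Matrix (Fin 2) (Fin 2) E)) :
    thetaTreeIso hϖ σ hσv hσσ M = M ↔ (Matrix.GeneralLinearGroup.mk'' _ (isUnit_det_theta' σ h))⁻¹ * h ∈ glInt 2 E := by
  rw [← Subtype.coe_inj, thetaTreeIso_apply_coe hϖ σ hσv hσσ M hM, hM]
  exact span_range_transpose_eq_iff (Matrix.GeneralLinearGroup.mk'' _ (isUnit_det_theta' σ h)) h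

include hσv in
/-- `|det (θ⁻¹ h)| = 1`. [folklore] -/
private theorem valuation_det_thetaInv_mul (h : GL (Fin 2) E) :
    valuation E ((((Matrix.GeneralLinearGroup.mk'' _ (isUnit_det_theta' σ h))⁻¹ * h : GL (Fin 2) E)) : Matrix (Fin 2) (Fin 2) E).det = 1 := by
  have hdet0 : valuation E ((h : Matrix (Fin 2) (Fin 2) E).det) ≠ 0 :=
    (Valuation.ne_zero_iff _).2 (h.isUnit.map Matrix.detMonoidHom).ne_zero
  rw [coe_thetaInv_mul, Matrix.det_mul, Matrix.det_nonsing_inv, Ring.inverse_eq_inv', map_mul, map_inv₀, det_theta', Valuation.map_neg, hσv,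
    inv_mul_cancel₀ hdet0]

include hσv in
/-- `|det (ᵗ(σg)·w·g)| = |det g|²`. [folklore] -/
private theorem valuation_det_formCongr_w (g : GL (Fin 2) E) :
    valuation E (formCongr σ g !![(0 : E), 1; 1, 0]).det = valuation E ((g : Matrix (Fin 2) (Fin 2) E).det) ^ 2 := by
  rw [formCongr_w_eq_smul, ← coe_thetaInv_mul, Matrix.det_smul, Matrix.det_mul, Fintype.card_fin, map_mul, map_mul, map_pow, hσv,
    valuation_det_thetaInv_mul σ hσv, Matrix.det_fin_two_of]
  simp

/-- In the value group, `a² = b² ⇒ a = b`. [folklore] -/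
private theorem eq_of_sq_eq_sq {a b : ValuativeRel.ValueGroupWithZero E} (hab : a ^ 2 = b ^ 2) : a = b := by
  rcases lt_trichotomy a b with h | h | h
  · exact absurd hab (ne_of_lt (pow_lt_pow_left₀ h zero_le two_ne_zero))
  · exact h
  · exact absurd hab (ne_of_gt (pow_lt_pow_left₀ h zero_le two_ne_zero))

/-- Integrality of `−(u • (J · A))` from integrality of `A` and `|u| ≤ 1`. [folklore] -/
private theorem isIntegralMatrix_neg_smul_J_mul {u : E} (hu : valuation E u ≤ 1) {A : Matrix (Fin 2) (Fin 2) E} (hA : ∀ i j, A i j ∈ 𝒪[E]) :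
    IsIntegralMatrix (-(u • (!![(0 : E), 1; -1, 0] * A))) := by
  intro i j
  rw [Matrix.neg_apply, Matrix.smul_apply, smul_eq_mul]
  refine neg_mem (Subring.mul_mem _ ((Valuation.mem_integer_iff _ _).2 hu) ?_)
  fin_cases i <;> fin_cases j <;> simp [Matrix.mul_apply, Fin.sum_univ_two] <;> exact hA _ _

/-- Integrality of `c • (J · A)` from integrality of `A` and `|c| ≤ 1`. [folklore] -/
private theorem isIntegralMatrix_smul_J_mul {c : E} (hc : valuation E c ≤ 1) {A : Matrix (Fin 2) (Fin 2) E} (hA : IsIntegralMatrix A) :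
    IsIntegralMatrix (c • (!![(0 : E), 1; -1, 0] * A)) := by
  intro i j
  rw [Matrix.smul_apply, smul_eq_mul]
  refine Subring.mul_mem _ ((Valuation.mem_integer_iff _ _).2 hc) ?_
  fin_cases i <;> fin_cases j <;> simp [Matrix.mul_apply, Fin.sum_univ_two] <;> exact hA _ _

include hσv in
/-- THE KEY STEP (⇐): a frame `g` whose `w`-Gram matrix is `c` times a unimodular matrix, `|c| = |det g|`, has `θ⁻¹ g ∈ GL₂(𝒪)`. [cite: Jacobowitz1962, §7–§8] -/
private theorem thetaInv_mul_mem_glInt_of_gram {g : GL (Fin 2) E} {c : E} (hc : valuation E c = valuation E ((g : Matrix (Fin 2) (Fin 2) E).det))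
    (hU : IsUnimodular₂ (c⁻¹ • formCongr σ g !![(0 : E), 1; 1, 0])) :
    (Matrix.GeneralLinearGroup.mk'' _ (isUnit_det_theta' σ g))⁻¹ * g ∈ glInt 2 E := by
  have hdetg0 : (g : Matrix (Fin 2) (Fin 2) E).det ≠ 0 := (g.isUnit.map Matrix.detMonoidHom).ne_zero
  have hvg0 : valuation E ((g : Matrix (Fin 2) (Fin 2) E).det) ≠ 0 := (Valuation.ne_zero_iff _).2 hdetg0
  have hc0 : c ≠ 0 := fun e => hvg0 (by rw [← hc, e, map_zero])
  have hσ0 : σ ((g : Matrix (Fin 2) (Fin 2) E).det) ≠ 0 := (map_ne_zero σ).2 hdetg0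
  refine mem_glInt_of_isIntegralMatrix ?_ (valuation_det_thetaInv_mul σ hσv g)
  -- `K = −(((σ det g)⁻¹ c) • (J · (c⁻¹ • G)))`, with `|(σ det g)⁻¹ c| = 1` and `c⁻¹ • G` integral
  have hG := formCongr_w_eq_smul σ g
  rw [← coe_thetaInv_mul] at hG
  have hK := eq_neg_smul_J_mul_of_eq hσ0 hG
  have hK' : ((((Matrix.GeneralLinearGroup.mk'' _ (isUnit_det_theta' σ g))⁻¹ * g : GL (Fin 2) E)) : Matrix (Fin 2) (Fin 2) E) =
      -(((σ ((g : Matrix (Fin 2) (Fin 2) E).det))⁻¹ * c) • (!![(0 : E), 1; -1, 0] * (c⁻¹ • formCongr σ g !![(0 : E), 1; 1, 0]))) := by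
    rw [Matrix.mul_smul, smul_smul, mul_assoc, mul_inv_cancel₀ hc0, mul_one]
    exact hK
  rw [hK']
  exact isIntegralMatrix_neg_smul_J_mul (by rw [map_mul, map_inv₀, hσv, hc, inv_mul_cancel₀ hvg0]) hU.1

/-- **(T.5) THE FIXED VERTICES OF `θ̄` ARE EXACTLY THE VERTICES OF THE `U(1,1)` TREE** (`w = (0 1; 1 0)`): `θ̄ M = M ↔ M.1` is `w`-self-dual or `w`-`ϖ`-modular
(`IsSpecialLattice σ ϖ w`).  Frame proof: `θ̄[latt h] = [latt h] ⇔ K = θ⁻¹h ∈ GL₂(𝒪)` (★ `span_range_transpose_eq_iff`), and `ᵗ(σh)·w·h = σ(det h) • J·K` with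
`|det h| ∈ {1, |ϖ|}`, `|det K| = 1`. «Tree in tree»: the `(q_F+1)`-regular tree of `U(1,1)_w` is the fixed subtree of the involution `θ̄` of the `(q_E+1)`-regular tree of
`GL₂(E_w)`. [cite: Rogawski1990, §4.11 pp. 58–60] [cite: Langlands1980AMS96, §5] [cite: Jacobowitz1962, §7–§8] -/
theorem thetaTreeIso_eq_self_iff (M : {M : Submodule 𝒪[E] (Fin 2 → E) // IsSpecialLattice (RingHom.id E) ϖ !![(0 : E), 1; -1, 0] M}) :
    thetaTreeIso hϖ σ hσv hσσ M = M ↔ IsSpecialLattice σ ϖ !![(0 : E), 1; 1, 0] M.1 := by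
  have h0 := hϖ.ne_zero
  have hv0 : valuation E ϖ ≠ 0 := (Valuation.ne_zero_iff _).2 h0
  constructor
  · intro hfix
    obtain ⟨h, e, he, hM, hdet⟩ := exists_latt_eq_of_isSpecialLattice h0 M.2
    have hk := (thetaTreeIso_eq_self_iff_mem_glInt hϖ σ hσv hσσ M hM).1 hfix
    have hint := isIntegralMatrix_of_mem_glInt hk
    have hG := formCongr_w_eq_smul σ h
    rw [← coe_thetaInv_mul] at hG
    have hvG := valuation_det_formCongr_w σ hσv h
    rcases he with rfl | rfl
    · -- `|det h| = 1`: the Gram matrix itself is unimodular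
      rw [zpow_zero, map_one] at hdet
      refine Or.inl ⟨h, hM, ?_, ?_⟩
      · rw [hG]; exact isIntegralMatrix_smul_J_mul (by rw [hσv, hdet]) hint
      · rw [hvG, hdet, one_pow]
    · -- `|det h| = |ϖ|`: `ϖ⁻¹ •` the Gram matrix is unimodular
      rw [zpow_one] at hdet
      refine Or.inr ⟨h, hM, ?_, ?_⟩
      · rw [hG, smul_smul]
        exact isIntegralMatrix_smul_J_mul (by rw [map_mul, map_inv₀, hσv, hdet, inv_mul_cancel₀ hv0]) hint
      · rw [Matrix.det_smul, Fintype.card_fin, map_mul, map_pow, map_inv₀, hvG, hdet, ← mul_pow, inv_mul_cancel₀ hv0, one_pow]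
  · rintro (⟨g, hMg, hU⟩ | ⟨g, hMg, hU⟩)
    · -- `w`-self-dual frame: `|det G| = 1 = |det g|²`
      have hvg : valuation E ((g : Matrix (Fin 2) (Fin 2) E).det) = 1 :=
        eq_of_sq_eq_sq (by rw [← valuation_det_formCongr_w σ hσv g, hU.2, one_pow])
      refine (thetaTreeIso_eq_self_iff_mem_glInt hϖ σ hσv hσσ M hMg).2 (thetaInv_mul_mem_glInt_of_gram σ hσv (c := 1) ?_ ?_)
      · rw [map_one, hvg]
      · rwa [inv_one, one_smul]
    · -- `w`-`ϖ`-modular frame: `|det (ϖ⁻¹ G)| = 1 ⇒ |det g|² = |ϖ|²`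
      have hvg : valuation E ((g : Matrix (Fin 2) (Fin 2) E).det) = valuation E ϖ := by
        refine eq_of_sq_eq_sq ?_
        have h2 := hU.2
        rw [Matrix.det_smul, Fintype.card_fin, map_mul, map_pow, map_inv₀, valuation_det_formCongr_w σ hσv g, ← mul_pow] at h2
        rw [← (inv_mul_eq_one₀ hv0).1 (eq_of_sq_eq_sq (h2.trans (one_pow 2).symm))]
      exact (thetaTreeIso_eq_self_iff_mem_glInt hϖ σ hσv hσσ M hMg).2 (thetaInv_mul_mem_glInt_of_gram σ hσv hvg.symm hU)

/-- **TYPE FOR TYPE**: a vertex is `w`-self-dual (a hyperspecial vertex of the `U(1,1)` tree) iff it is `θ̄`-fixed and even (`|det| = 1`) in the tree of `GL₂(E)`;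
likewise `w`-`ϖ`-modular ⇔ `θ̄`-fixed and odd.  (The two colourings agree on the fixed subtree.) [cite: Rogawski1990, §4.11 pp. 58–60] [cite: Jacobowitz1962, §7–§8] -/
theorem isSelfDualLattice_hermitian_iff (M : {M : Submodule 𝒪[E] (Fin 2 → E) // IsSpecialLattice (RingHom.id E) ϖ !![(0 : E), 1; -1, 0] M}) :
    IsSelfDualLattice σ !![(0 : E), 1; 1, 0] M.1 ↔
      thetaTreeIso hϖ σ hσv hσσ M = M ∧ IsSelfDualLattice (RingHom.id E) !![(0 : E), 1; -1, 0] M.1 := by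
  constructor
  · intro hsd
    refine ⟨(thetaTreeIso_eq_self_iff hϖ σ hσv hσσ M).2 (Or.inl hsd), ?_⟩
    obtain ⟨g, hMg, hU⟩ := hsd
    have hvg : valuation E ((g : Matrix (Fin 2) (Fin 2) E).det) = 1 :=
      eq_of_sq_eq_sq (by rw [← valuation_det_formCongr_w σ hσv g, hU.2, one_pow])
    exact (isSelfDualLattice_id_altJ_iff _).2 ⟨g, hMg, hvg⟩
  · rintro ⟨hfix, hsd⟩
    rcases (thetaTreeIso_eq_self_iff hϖ σ hσv hσσ M).1 hfix with h | ⟨g, hMg, hU⟩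
    · exact h
    · -- a `ϖ`-modular `w`-frame has `|det g| = |ϖ|`, contradicting evenness
      exfalso
      obtain ⟨g', hMg', hdet'⟩ := (isSelfDualLattice_id_altJ_iff _).1 hsd
      have hv0 : valuation E ϖ ≠ 0 := (Valuation.ne_zero_iff _).2 hϖ.ne_zero
      have hvg : valuation E ((g : Matrix (Fin 2) (Fin 2) E).det) = valuation E ϖ := by
        refine eq_of_sq_eq_sq ?_
        have h2 := hU.2
        rw [Matrix.det_smul, Fintype.card_fin, map_mul, map_pow, map_inv₀, valuation_det_formCongr_w σ hσv g, ← mul_pow] at h2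
        rw [← (inv_mul_eq_one₀ hv0).1 (eq_of_sq_eq_sq (h2.trans (one_pow 2).symm))]
      -- `latt g = latt g'` forces `|det g| = |det g'|`
      have hk : g⁻¹ * g' ∈ glInt 2 E := (span_range_transpose_eq_iff g g').1 (hMg.symm.trans hMg')
      have hdk := valuation_det_eq_one_of_mem_glInt hk
      rw [Units.val_mul, Matrix.det_mul, Matrix.coe_units_inv, Matrix.det_nonsing_inv, Ring.inverse_eq_inv', map_mul, map_inv₀, hvg, hdet',
        mul_one, inv_eq_one] at hdk
      exact hϖ.valuation_lt_one.ne hdk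

end Fixed

/-! ## §3 (T.4) The semiconjugation `θ̄ (g • M) = Θ(g) • θ̄ M` -/

section SemiconjAlgebra

variable (σ : E →+* E)

/-- **`Θ(g) = (σ det g)⁻¹ • D σ(g) D` at rank 2**: the matrix of `w ᵗ(σg)⁻¹ w` (★ `UnitaryGroup.coe_qsInvolution_apply` + the `2 × 2` adjugate). [cite: Rogawski1990, §1.9 p. 8] -/
private theorem coe_qsInvolution_two (g : GL (Fin 2) E) :
    ((UnitaryGroup.qsInvolution σ g : GL (Fin 2) E) : Matrix (Fin 2) (Fin 2) E) =
      (σ ((g : Matrix (Fin 2) (Fin 2) E).det))⁻¹ •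
        !![σ ((g : Matrix (Fin 2) (Fin 2) E) 0 0), -σ ((g : Matrix (Fin 2) (Fin 2) E) 0 1);
          -σ ((g : Matrix (Fin 2) (Fin 2) E) 1 0), σ ((g : Matrix (Fin 2) (Fin 2) E) 1 1)] := by
  have hinv : ((g⁻¹ : GL (Fin 2) E) : Matrix (Fin 2) (Fin 2) E) =
      ((g : Matrix (Fin 2) (Fin 2) E).det)⁻¹ • !![(g : Matrix (Fin 2) (Fin 2) E) 1 1, -(g : Matrix (Fin 2) (Fin 2) E) 0 1;
        -(g : Matrix (Fin 2) (Fin 2) E) 1 0, (g : Matrix (Fin 2) (Fin 2) E) 0 0] := by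
    rw [Matrix.coe_units_inv, Matrix.inv_def, Ring.inverse_eq_inv', Matrix.adjugate_fin_two]
  have r0 : Fin.rev (0 : Fin 2) = 1 := rfl
  have r1 : Fin.rev (1 : Fin 2) = 0 := rfl
  ext i j
  rw [UnitaryGroup.coe_qsInvolution_apply, hinv]
  fin_cases i <;> fin_cases j <;> simp [r0, r1, map_mul, map_neg, map_inv₀]

/-- `(D σ(g) D) · (D σ(h)) = D σ(g h)`: the θ-frames are multiplicative under the conjugated action. [folklore] -/
private theorem conjFrame_mul_theta (g h : GL (Fin 2) E) :
    (!![σ ((g : Matrix (Fin 2) (Fin 2) E) 0 0), -σ ((g : Matrix (Fin 2) (Fin 2) E) 0 1);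
        -σ ((g : Matrix (Fin 2) (Fin 2) E) 1 0), σ ((g : Matrix (Fin 2) (Fin 2) E) 1 1)] : Matrix (Fin 2) (Fin 2) E) *
      !![-σ ((h : Matrix (Fin 2) (Fin 2) E) 0 0), -σ ((h : Matrix (Fin 2) (Fin 2) E) 0 1);
        σ ((h : Matrix (Fin 2) (Fin 2) E) 1 0), σ ((h : Matrix (Fin 2) (Fin 2) E) 1 1)] =
      !![-σ (((g * h : GL (Fin 2) E) : Matrix (Fin 2) (Fin 2) E) 0 0), -σ (((g * h : GL (Fin 2) E) : Matrix (Fin 2) (Fin 2) E) 0 1);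
        σ (((g * h : GL (Fin 2) E) : Matrix (Fin 2) (Fin 2) E) 1 0), σ (((g * h : GL (Fin 2) E) : Matrix (Fin 2) (Fin 2) E) 1 1)] := by
  ext i j
  rw [Units.val_mul]
  fin_cases i <;> fin_cases j <;> simp [Matrix.mul_apply, Fin.sum_univ_two] <;> ring

/-- `det (c • h)` is a unit for `c ≠ 0`. [folklore] -/
private theorem isUnit_det_smul' {c : E} (hc : c ≠ 0) (h : GL (Fin 2) E) : IsUnit (c • (h : Matrix (Fin 2) (Fin 2) E)).det := by
  rw [Matrix.det_smul, Fintype.card_fin]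
  exact (isUnit_iff_ne_zero.2 (pow_ne_zero _ hc)).mul (h.isUnit.map Matrix.detMonoidHom)

/-- The θ-frame of `c • h` is `σ(c) •` the θ-frame of `h`. [folklore] -/
private theorem theta_smul (c : E) (hc : c ≠ 0) (h : GL (Fin 2) E) :
    (!![-σ (((Matrix.GeneralLinearGroup.mk'' _ (isUnit_det_smul' hc h) : GL (Fin 2) E) : Matrix (Fin 2) (Fin 2) E) 0 0),
        -σ (((Matrix.GeneralLinearGroup.mk'' _ (isUnit_det_smul' hc h) : GL (Fin 2) E) : Matrix (Fin 2) (Fin 2) E) 0 1);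
        σ (((Matrix.GeneralLinearGroup.mk'' _ (isUnit_det_smul' hc h) : GL (Fin 2) E) : Matrix (Fin 2) (Fin 2) E) 1 0),
        σ (((Matrix.GeneralLinearGroup.mk'' _ (isUnit_det_smul' hc h) : GL (Fin 2) E) : Matrix (Fin 2) (Fin 2) E) 1 1)] :
        Matrix (Fin 2) (Fin 2) E) =
      σ c • !![-σ ((h : Matrix (Fin 2) (Fin 2) E) 0 0), -σ ((h : Matrix (Fin 2) (Fin 2) E) 0 1);
        σ ((h : Matrix (Fin 2) (Fin 2) E) 1 0), σ ((h : Matrix (Fin 2) (Fin 2) E) 1 1)] := by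
  have hv : ∀ i j, ((Matrix.GeneralLinearGroup.mk'' _ (isUnit_det_smul' hc h) : GL (Fin 2) E) : Matrix (Fin 2) (Fin 2) E) i j =
      c * (h : Matrix (Fin 2) (Fin 2) E) i j := fun i j => rfl
  ext i j
  fin_cases i <;> fin_cases j <;> simp [hv, map_mul, mul_neg]

end SemiconjAlgebra

section Semiconj

variable [ValuativeRel E] [IsDiscreteValuationRing 𝒪[E]] {ϖ : E} (hϖ : IsUniformizingElement ϖ) (σ : E →+* E)
  (hσv : ∀ x : E, valuation E (σ x) = valuation E x) (hσσ : ∀ x : E, σ (σ x) = x)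

/-- **(T.4) SEMICONJUGATION `θ̄ (g • M) = Θ(g) • θ̄ M`** (`• = glVertexAct hϖ`, the action of `GL₂(E)` through `PGL₂(E)` on the tree; `Θ = UnitaryGroup.qsInvolution σ`).
Frames: `g•[latt h] = [latt (ϖᵏ·gh)]`, `θ̄` of it `= [latt (σ(ϖᵏ)·Dσ(gh))] = [latt ((Dσ(g)D)·Dσ(h))] = Θ(g)•[latt (Dσ h)]` (scalars `σϖᵏ`, `(σ det g)⁻¹` die in `PGL₂`;
★ `glVertexAct_eq_iff`).  Hence `τ_δ := glTreeIso δ ∘ θ̄` satisfies `τ_δ(g•x) = (δΘ(g)δ⁻¹)•τ_δ(x)` and `τ_δ² = (δ·Θδ)•` — the twisted displacement map whose shells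
`d(x, τ_δ x)` FILE 2 counts (★ W9-c, ★ W8-f). [cite: Rogawski1990, §4.11 pp. 58–60] [cite: Langlands1980AMS96, §5] [cite: Serre1980Trees, Ch. II §1.2–§1.3] -/
theorem thetaTreeIso_glVertexAct (g : GL (Fin 2) E)
    (M : {M : Submodule 𝒪[E] (Fin 2 → E) // IsSpecialLattice (RingHom.id E) ϖ !![(0 : E), 1; -1, 0] M}) :
    thetaTreeIso hϖ σ hσv hσσ (glVertexAct hϖ g M) = glVertexAct hϖ (UnitaryGroup.qsInvolution σ g) (thetaTreeIso hϖ σ hσv hσσ M) := by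
  have h0 := hϖ.ne_zero
  obtain ⟨h, e, -, hM, -⟩ := exists_latt_eq_of_isSpecialLattice h0 M.2
  obtain ⟨k, hk⟩ := (glVertexAct_eq_iff hϖ g M _).1 rfl
  -- the frame `ϖ^k • (g h)` of `g • M`
  have hF : (glVertexAct hϖ g M).1 =
      latt ((Matrix.GeneralLinearGroup.mk'' _ (isUnit_det_smul' (zpow_ne_zero k h0) (g * h)) : GL (Fin 2) E) : Matrix (Fin 2) (Fin 2) E) := by
    rw [hk, hM, mapGL_latt, scaleLattice_latt]; rfl
  -- the scalar `σ(ϖ^k) σ(det g) = ϖ^m · unit`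
  have hdet0 : (g : Matrix (Fin 2) (Fin 2) E).det ≠ 0 := (g.isUnit.map Matrix.detMonoidHom).ne_zero
  have hσd0 : σ ((g : Matrix (Fin 2) (Fin 2) E).det) ≠ 0 := (map_ne_zero σ).2 hdet0
  have hσϖ0 : σ (ϖ ^ k) ≠ 0 := (map_ne_zero σ).2 (zpow_ne_zero k h0)
  obtain ⟨m, u, hu, hm⟩ := exists_eq_zpow_mul_of_ne_zero hϖ (mul_ne_zero hσϖ0 hσd0)
  symm
  refine (glVertexAct_eq_iff hϖ _ _ _).2 ⟨m, ?_⟩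
  rw [thetaTreeIso_apply_coe hϖ σ hσv hσσ _ hF, thetaTreeIso_apply_coe hϖ σ hσv hσσ M hM, theta_smul σ _ (zpow_ne_zero k h0),
    mapGL, ← latt_mul, coe_qsInvolution_two, Matrix.smul_mul, conjFrame_mul_theta, ← scaleLattice_latt, ← scaleLattice_latt, scaleLattice_scaleLattice]
  -- `σ(ϖ^k) • L = (ϖ^m (σ det g)⁻¹) • L`, as `σ(ϖ^k) = ϖ^m (σ det g)⁻¹ u` with `|u| = 1`
  have hscal : σ (ϖ ^ k) = ϖ ^ m * (σ ((g : Matrix (Fin 2) (Fin 2) E).det))⁻¹ * u := by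
    rw [mul_right_comm, ← hm, mul_inv_cancel_right₀ hσd0]
  rw [hscal, ← scaleLattice_scaleLattice (ϖ ^ m * _) u]
  congr 1
  exact scaleLattice_latt_eq_of_valuation_eq_one hu
    (Matrix.GeneralLinearGroup.mk'' _ (isUnit_det_theta' σ (g * h)))

end Semiconj


end Summit.HodgeConjecture.HodgeConjecture.R90.S6

end
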